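import Mathlib
import Summits.NavierStokesRegularity.NavierStokesRegularity.Theorems.PlaneEnergyCeilingSlabEnergyIdentitySlab

/-!
# Route PlaneEnergyCeiling · crux `PlanarEnergyAPriori` — the planar Agmon inequality

Helper file for the crux item stmt-NavierStokesRegularity-16855 (`PlanarEnergyAPriori`, route
`PlaneEnergyCeiling`), landed `--supports` that item: the KINEMATIC A-PRIORI FLOOR of the crux
(strategist census `Cruxes/PlanarEnergyAPriori/STRATEGY-CENSUS.md`, "planar Agmon inequality",
the first lemma of the slab-law line `birth`).

**Statements.**
* `enorm_sq_le_lintegral_enorm_mul_enorm_deriv` — the 1-D Agmon inequality in `ℝ≥0∞` form: for a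
  `C¹` curve `g : ℝ → F` into a real inner product space with `∫ ‖g‖² < ∞`,
  `‖g c‖² ≤ ∫_ℝ ‖g‖ ‖g'‖` for every `c` (sharp constant `1`).
* `planarEnergy_le_lintegral_enorm_mul_enorm_fderiv` — the PLANAR AGMON INEQUALITY: for a `C¹`
  field `w : ℝ³ → F` with `∫ ‖w‖² < ∞`, every planar energy is controlled by the whole-space
  product of `w` and its NORMAL derivative,
  `∫_{ℝ²} ‖w(R(y₀,y₁,c))‖² dy ≤ ∫_{ℝ³} ‖w‖ ‖∂_{Re₂} w‖ dx`, uniformly in the direction `R` and the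
  offset `c`;
* `planarEnergy_sq_le_lintegral_mul_lintegral` — the Cauchy–Schwarz form
  `E(w;R,c)² ≤ ‖w‖₂² ‖∂_{Re₂} w‖₂²`, and `planarEnergy_sq_le_lintegral_mul_lintegral_fderiv` with
  the full derivative `‖Dw‖` in place of the normal one (primed: section form; unprimed: the
  registered closed form).

So `√E` is a one-dimensional `H¹` trace quantity: the planar ceiling of a finite-energy field is
finite as soon as its gradient is square integrable, and along a Leray–Hopf solution the planar
ceiling `P(t)` is a priori in `L²(0,T)` (the crux is the `L²_t → L^∞_t` upgrade).

**Proofs.** 1-D: `‖g‖²` has derivative `2⟪g, g'⟫`; integrate from `a < c` and up to `b > c`,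
where `‖g a‖², ‖g b‖²` are small because `‖g‖²` is integrable on the half-lines (if `‖g‖² > ε`
on a half-line its integral is infinite), and bound `|⟪g, g'⟫| ≤ ‖g‖ ‖g'‖`. Planar: apply the 1-D
inequality on almost every normal line `s ↦ R(y₀,y₁,s)` (Tonelli through the measure-preserving
slab chart `exists_slabChart` and the isometry `R`), then Tonelli again and Hölder.
Folklore (Agmon's inequality; Lemarié-Rieusset 2016, Ch. 11, trace form of the energy class).
-/

noncomputable section

-- single-conjunct summit: `Summit.<Summit>.<Problem>` repeats the name by the D-0017 layout
set_option linter.dupNamespace false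

namespace Summit.NavierStokesRegularity.NavierStokesRegularity.Theorems.PlanarEnergyAPriori

open MeasureTheory Set Filter Topology WithLp
open scoped ENNReal RealInnerProductSpace
open Summit.NavierStokesRegularity.NavierStokesRegularity.Theorems.PlaneEnergyCeilingSlabEnergyIdentity

section OneDim

variable {F : Type*} [NormedAddCommGroup F] [InnerProductSpace ℝ F]

omit [InnerProductSpace ℝ F] in
/-- A function `g : ℝ → F` with `∫ ‖g‖² < ∞` takes a value with `‖g a‖² ≤ ε` at some point
`a ≤ c` of every left half-line (which has infinite measure). -/
theorem exists_le_norm_sq_le_of_lintegral_lt_top {g : ℝ → F} (hL2 : ∫⁻ s, ‖g s‖ₑ ^ 2 < ∞)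
    {ε : ℝ} (hε : 0 < ε) (c : ℝ) : ∃ a ≤ c, ‖g a‖ ^ 2 ≤ ε := by
  by_contra h
  push Not at h
  have hconst : ∫⁻ _ in Iic c, ENNReal.ofReal ε ≤ ∫⁻ s in Iic c, ‖g s‖ₑ ^ 2 := by
    refine setLIntegral_mono' measurableSet_Iic fun s hs => ?_
    rw [← ofReal_norm, ← ENNReal.ofReal_pow (norm_nonneg _)]
    exact ENNReal.ofReal_le_ofReal (h s hs).le
  rw [setLIntegral_const, Real.volume_Iic, ENNReal.mul_top (by simpa using hε)] at hconst
  exact (lt_of_le_of_lt (top_le_iff.1 hconst).ge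
    ((setLIntegral_le_lintegral (Iic c) _).trans_lt hL2)).false

omit [InnerProductSpace ℝ F] in
/-- The same on the right half-line: some `b ≥ c` with `‖g b‖² ≤ ε`. -/
theorem exists_ge_norm_sq_le_of_lintegral_lt_top {g : ℝ → F} (hL2 : ∫⁻ s, ‖g s‖ₑ ^ 2 < ∞)
    {ε : ℝ} (hε : 0 < ε) (c : ℝ) : ∃ b ≥ c, ‖g b‖ ^ 2 ≤ ε := by
  by_contra h
  push Not at h
  have hconst : ∫⁻ _ in Ici c, ENNReal.ofReal ε ≤ ∫⁻ s in Ici c, ‖g s‖ₑ ^ 2 := by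
    refine setLIntegral_mono' measurableSet_Ici fun s hs => ?_
    rw [← ofReal_norm, ← ENNReal.ofReal_pow (norm_nonneg _)]
    exact ENNReal.ofReal_le_ofReal (h s hs).le
  rw [setLIntegral_const, Real.volume_Ici, ENNReal.mul_top (by simpa using hε)] at hconst
  exact (lt_of_le_of_lt (top_le_iff.1 hconst).ge
    ((setLIntegral_le_lintegral (Ici c) _).trans_lt hL2)).false

/-- **The 1-D Agmon inequality** (`ℝ≥0∞` form, sharp constant): for a `C¹` curve `g : ℝ → F` in a
real inner product space with `∫ ‖g‖² < ∞` and derivative `g'`,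
`‖g c‖² ≤ ∫_ℝ ‖g s‖ ‖g' s‖ ds` for every `c`. (If the right side is infinite there is nothing to
prove; otherwise `‖g‖²` is absolutely continuous with derivative `2⟪g, g'⟫`, and its values at
suitable far-away points on both sides are small.) [folklore: Agmon's inequality] -/
theorem enorm_sq_le_lintegral_enorm_mul_enorm_deriv {g g' : ℝ → F} (hg : ∀ s, HasDerivAt g (g' s) s)
    (hg' : Continuous g') (hL2 : ∫⁻ s, ‖g s‖ₑ ^ 2 < ∞) (c : ℝ) :
    ‖g c‖ₑ ^ 2 ≤ ∫⁻ s, ‖g s‖ₑ * ‖g' s‖ₑ := by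
  by_cases htop : ∫⁻ s, ‖g s‖ₑ * ‖g' s‖ₑ = ∞
  · rw [htop]; exact le_top
  have hgc : Continuous g := continuous_iff_continuousAt.2 fun s => (hg s).continuousAt
  -- the real integrand `h = ‖g‖ ‖g'‖` is integrable
  set h : ℝ → ℝ := fun s => ‖g s‖ * ‖g' s‖ with hh
  have hhc : Continuous h := hgc.norm.mul hg'.norm
  have hh0 : ∀ s, 0 ≤ h s := fun s => by positivity
  have hhe : ∀ s, ENNReal.ofReal (h s) = ‖g s‖ₑ * ‖g' s‖ₑ := fun s => by
    rw [hh, ENNReal.ofReal_mul (norm_nonneg _), ofReal_norm, ofReal_norm]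
  have hlin : ∫⁻ s, ‖g s‖ₑ * ‖g' s‖ₑ = ∫⁻ s, ENNReal.ofReal (h s) := by simp_rw [hhe]
  have hint : Integrable h := by
    refine ⟨hhc.aestronglyMeasurable, ?_⟩
    rw [hasFiniteIntegral_iff_enorm]
    have : ∀ s, ‖h s‖ₑ = ENNReal.ofReal (h s) := fun s => by
      rw [Real.enorm_eq_ofReal (hh0 s)]
    simp_rw [this, ← hlin]
    exact lt_top_iff_ne_top.2 htop
  have hIeq : ∫ s, h s = (∫⁻ s, ‖g s‖ₑ * ‖g' s‖ₑ).toReal := by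
    rw [hlin, integral_eq_lintegral_of_nonneg_ae (Eventually.of_forall hh0) hhc.aestronglyMeasurable]
  -- derivative of `‖g‖²` and the interval bounds
  have hderiv : ∀ s, HasDerivAt (fun s => ‖g s‖ ^ 2) (2 * ⟪g s, g' s⟫) s := fun s => (hg s).norm_sq
  have hdc : Continuous fun s => 2 * ⟪g s, g' s⟫ := continuous_const.mul (hgc.inner hg')
  have hFTC : ∀ a b, ‖g b‖ ^ 2 - ‖g a‖ ^ 2 = ∫ s in a..b, 2 * ⟪g s, g' s⟫ := fun a b =>
    (intervalIntegral.integral_eq_sub_of_hasDerivAt (fun s _ => hderiv s) (hdc.intervalIntegrable a b)).symm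
  -- `|∫_a^b 2⟪g,g'⟫| ≤ 2 ∫_a^b h` for `a ≤ b`
  have hbound : ∀ a b, a ≤ b → |∫ s in a..b, 2 * ⟪g s, g' s⟫| ≤ 2 * ∫ s in a..b, h s := by
    intro a b hab
    calc |∫ s in a..b, 2 * ⟪g s, g' s⟫| ≤ ∫ s in a..b, |2 * ⟪g s, g' s⟫| :=
          intervalIntegral.abs_integral_le_integral_abs hab
      _ ≤ ∫ s in a..b, 2 * h s := by
          refine intervalIntegral.integral_mono_on hab (hdc.abs.intervalIntegrable a b)
            ((continuous_const.mul hhc).intervalIntegrable a b) fun s _ => ?_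
          rw [abs_mul, abs_two, hh]
          exact mul_le_mul_of_nonneg_left (abs_real_inner_le_norm _ _) zero_le_two
      _ = 2 * ∫ s in a..b, h s := intervalIntegral.integral_const_mul 2 h
  -- `∫_a^b h ≤ ∫_ℝ h` for `a ≤ b`
  have hsub : ∀ a b, a ≤ b → ∫ s in a..b, h s ≤ ∫ s, h s := by
    intro a b hab
    rw [intervalIntegral.integral_of_le hab]
    exact setIntegral_le_integral hint (Eventually.of_forall hh0)
  -- conclude in `ℝ`: `‖g c‖² ≤ ∫ h + ε` for every `ε > 0`
  have hreal : ‖g c‖ ^ 2 ≤ ∫ s, h s := by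
    refine le_of_forall_pos_le_add fun ε hε => ?_
    obtain ⟨a, hac, ha⟩ := exists_le_norm_sq_le_of_lintegral_lt_top hL2 hε c
    obtain ⟨b, hbc, hb⟩ := exists_ge_norm_sq_le_of_lintegral_lt_top hL2 hε c
    have h1 := hFTC a c
    have h2 := hFTC c b
    have h3 := (abs_le.1 (hbound a c hac)).2
    have h4 := (abs_le.1 (hbound c b hbc)).1
    have hadd : (∫ s in a..c, h s) + ∫ s in c..b, h s = ∫ s in a..b, h s :=
      intervalIntegral.integral_add_adjacent_intervals (hhc.intervalIntegrable a c)
        (hhc.intervalIntegrable c b)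
    have h5 := hsub a b (hac.trans hbc)
    linarith [sq_nonneg ‖g a‖, sq_nonneg ‖g b‖]
  -- back to `ℝ≥0∞`
  calc ‖g c‖ₑ ^ 2 = ENNReal.ofReal (‖g c‖ ^ 2) := by
        rw [← ofReal_norm, ENNReal.ofReal_pow (norm_nonneg _)]
    _ ≤ ENNReal.ofReal (∫ s, h s) := ENNReal.ofReal_le_ofReal hreal
    _ = ∫⁻ s, ‖g s‖ₑ * ‖g' s‖ₑ := by rw [hIeq, ENNReal.ofReal_toReal htop]

end OneDim

/-! ### The planar inequality on `ℝ³` -/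

section Planar

variable {F : Type*} [NormedAddCommGroup F] [InnerProductSpace ℝ F]

/-- The normal line through a point of the plane `R({x₂ = c})`: `s ↦ R (y₀, y₁, s)` has velocity
`R e₂`. -/
theorem hasDerivAt_isometry_toLp_vec3 (R : EuclideanSpace ℝ (Fin 3) ≃ₗᵢ[ℝ] EuclideanSpace ℝ (Fin 3))
    (y : EuclideanSpace ℝ (Fin 2)) (s : ℝ) :
    HasDerivAt (fun s : ℝ => R (toLp 2 ![y 0, y 1, s])) (R (EuclideanSpace.single 2 1)) s := by
  have h := (R.toContinuousLinearEquiv : EuclideanSpace ℝ (Fin 3) →L[ℝ] EuclideanSpace ℝ (Fin 3)).hasFDerivAt.comp_hasDerivAt s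
    (hasDerivAt_toLp_vec3 y s)
  simpa [Function.comp_def] using h

omit [InnerProductSpace ℝ F] in
/-- Chain rule on the normal line: `d/ds w(R(y₀,y₁,s)) = Dw(R(y₀,y₁,s)) (R e₂)`. -/
theorem hasDerivAt_comp_normalLine [NormedSpace ℝ F] {w : EuclideanSpace ℝ (Fin 3) → F} (hw : Differentiable ℝ w)
    (R : EuclideanSpace ℝ (Fin 3) ≃ₗᵢ[ℝ] EuclideanSpace ℝ (Fin 3)) (y : EuclideanSpace ℝ (Fin 2)) (s : ℝ) :
    HasDerivAt (fun s : ℝ => w (R (toLp 2 ![y 0, y 1, s])))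
      (fderiv ℝ w (R (toLp 2 ![y 0, y 1, s])) (R (EuclideanSpace.single 2 1))) s :=
  (hw _).hasFDerivAt.comp_hasDerivAt s (hasDerivAt_isometry_toLp_vec3 R y s)

/-- Measurability of the normal-line integrals `y ↦ ∫_ℝ f(R(y₀,y₁,s)) ds` of a measurable
`f : ℝ³ → ℝ≥0∞` (Tonelli's measurability through the slab chart). -/
theorem measurable_lintegral_normalLine {f : EuclideanSpace ℝ (Fin 3) → ℝ≥0∞} (hf : Measurable f)
    (R : EuclideanSpace ℝ (Fin 3) ≃ₗᵢ[ℝ] EuclideanSpace ℝ (Fin 3)) :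
    Measurable fun y : EuclideanSpace ℝ (Fin 2) => ∫⁻ s : ℝ, f (R (toLp 2 ![y 0, y 1, s])) := by
  obtain ⟨e, -, heq⟩ := exists_slabChart
  have hm : Measurable fun z : ℝ × EuclideanSpace ℝ (Fin 2) => f (R (e z)) :=
    hf.comp (R.continuous.measurable.comp e.measurable)
  have hfun : (fun y : EuclideanSpace ℝ (Fin 2) => ∫⁻ s : ℝ, f (R (toLp 2 ![y 0, y 1, s]))) =
      fun y => ∫⁻ s : ℝ, (fun z : ℝ × EuclideanSpace ℝ (Fin 2) => f (R (e z))) (s, y) := by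
    simp only [heq]
  rw [hfun]
  exact hm.lintegral_prod_left'

/-- **Tonelli along the normal foliation.** For measurable `f : ℝ³ → ℝ≥0∞` and a linear isometry
`R`: `∫_{ℝ³} f = ∫_{y ∈ ℝ²} ∫_{s ∈ ℝ} f(R(y₀,y₁,s))` (the slab chart `(s,y) ↦ (y₀,y₁,s)` and `R`
preserve Lebesgue measure). -/
theorem lintegral_eq_lintegral_lintegral_normalLine {f : EuclideanSpace ℝ (Fin 3) → ℝ≥0∞} (hf : Measurable f)
    (R : EuclideanSpace ℝ (Fin 3) ≃ₗᵢ[ℝ] EuclideanSpace ℝ (Fin 3)) :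
    ∫⁻ x, f x = ∫⁻ y : EuclideanSpace ℝ (Fin 2), ∫⁻ s : ℝ, f (R (toLp 2 ![y 0, y 1, s])) := by
  obtain ⟨e, he, heq⟩ := exists_slabChart
  have hm : Measurable fun z : ℝ × EuclideanSpace ℝ (Fin 2) => f (R (e z)) :=
    hf.comp (R.continuous.measurable.comp e.measurable)
  calc ∫⁻ x, f x = ∫⁻ x, f (R x) := (R.measurePreserving.lintegral_comp hf).symm
    _ = ∫⁻ z, f (R (e z)) := (he.lintegral_comp (hf.comp R.continuous.measurable)).symm
    _ = ∫⁻ z, f (R (e z)) ∂((volume : Measure ℝ).prod (volume : Measure (EuclideanSpace ℝ (Fin 2)))) := by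
        rw [Measure.volume_eq_prod]
    _ = ∫⁻ y : EuclideanSpace ℝ (Fin 2), ∫⁻ s : ℝ, f (R (e (s, y))) := lintegral_prod_symm' _ hm
    _ = ∫⁻ y : EuclideanSpace ℝ (Fin 2), ∫⁻ s : ℝ, f (R (toLp 2 ![y 0, y 1, s])) := by
        simp only [heq]

/-- **The planar Agmon inequality.** For a `C¹` field `w : ℝ³ → F` (real inner product space
values) with `∫ ‖w‖² < ∞`, every planar energy is bounded by the whole-space integral of
`‖w‖ ‖∂ₙw‖`, `∂ₙ = D(·)(R e₂)` the derivative normal to the plane: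
`∫_{ℝ²} ‖w(R(y₀,y₁,c))‖² dy ≤ ∫_{ℝ³} ‖w x‖ ‖Dw(x)(R e₂)‖ dx`, for every linear isometry `R` and
every offset `c`. (1-D Agmon on almost every normal line, then Tonelli.) [folklore] -/
theorem planarEnergy_le_lintegral_enorm_mul_enorm_fderiv {w : EuclideanSpace ℝ (Fin 3) → F} (hw : ContDiff ℝ 1 w)
    (hL2 : ∫⁻ x, ‖w x‖ₑ ^ 2 < ∞) (R : EuclideanSpace ℝ (Fin 3) ≃ₗᵢ[ℝ] EuclideanSpace ℝ (Fin 3)) (c : ℝ) :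
    ∫⁻ y : EuclideanSpace ℝ (Fin 2), ‖w (R (toLp 2 ![y 0, y 1, c]))‖ₑ ^ 2 ≤
      ∫⁻ x, ‖w x‖ₑ * ‖fderiv ℝ w x (R (EuclideanSpace.single 2 1))‖ₑ := by
  have hwc : Continuous w := hw.continuous
  have hdiff : Differentiable ℝ w := hw.differentiable one_ne_zero
  have hdw : Continuous fun x => fderiv ℝ w x (R (EuclideanSpace.single 2 1)) :=
    (hw.continuous_fderiv one_ne_zero).clm_apply continuous_const
  have hm2 : Measurable fun x => ‖w x‖ₑ ^ 2 :=
    (continuous_enorm.comp hwc).measurable.pow_const 2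
  have hmp : Measurable fun x => ‖w x‖ₑ * ‖fderiv ℝ w x (R (EuclideanSpace.single 2 1))‖ₑ :=
    (continuous_enorm.comp hwc).measurable.mul (continuous_enorm.comp hdw).measurable
  -- almost every normal line carries finite `L²` mass
  have hae : ∀ᵐ y : EuclideanSpace ℝ (Fin 2), ∫⁻ s : ℝ, ‖w (R (toLp 2 ![y 0, y 1, s]))‖ₑ ^ 2 < ∞ := by
    refine ae_lt_top (measurable_lintegral_normalLine hm2 R) ?_
    rw [← lintegral_eq_lintegral_lintegral_normalLine hm2 R]
    exact hL2.ne
  have hline : Continuous fun s : ℝ => (toLp 2 ![(0 : EuclideanSpace ℝ (Fin 2)) 0, (0 : EuclideanSpace ℝ (Fin 2)) 1, s] : EuclideanSpace ℝ (Fin 3)) :=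
    continuous_iff_continuousAt.2 fun s => (hasDerivAt_toLp_vec3 0 s).continuousAt
  calc ∫⁻ y : EuclideanSpace ℝ (Fin 2), ‖w (R (toLp 2 ![y 0, y 1, c]))‖ₑ ^ 2
      ≤ ∫⁻ y : EuclideanSpace ℝ (Fin 2), ∫⁻ s : ℝ, ‖w (R (toLp 2 ![y 0, y 1, s]))‖ₑ *
          ‖fderiv ℝ w (R (toLp 2 ![y 0, y 1, s])) (R (EuclideanSpace.single 2 1))‖ₑ := by
        refine lintegral_mono_ae ?_
        filter_upwards [hae] with y hy
        have hl : Continuous fun s : ℝ => R (toLp 2 ![y 0, y 1, s]) :=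
          continuous_iff_continuousAt.2 fun s => (hasDerivAt_isometry_toLp_vec3 R y s).continuousAt
        exact enorm_sq_le_lintegral_enorm_mul_enorm_deriv (fun s => hasDerivAt_comp_normalLine hdiff R y s)
          (hdw.comp hl) hy c
    _ = ∫⁻ x, ‖w x‖ₑ * ‖fderiv ℝ w x (R (EuclideanSpace.single 2 1))‖ₑ :=
        (lintegral_eq_lintegral_lintegral_normalLine hmp R).symm

/-- **Planar Agmon, Cauchy–Schwarz form.** Under the same hypotheses,
`E(w;R,c)² ≤ (∫ ‖w‖²) · ∫ ‖Dw(x)(R e₂)‖² dx`: the planar energy is at most the geometric mean of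
the energy and the normal-derivative energy. [folklore] -/
theorem planarEnergy_sq_le_lintegral_mul_lintegral {w : EuclideanSpace ℝ (Fin 3) → F} (hw : ContDiff ℝ 1 w)
    (hL2 : ∫⁻ x, ‖w x‖ₑ ^ 2 < ∞) (R : EuclideanSpace ℝ (Fin 3) ≃ₗᵢ[ℝ] EuclideanSpace ℝ (Fin 3)) (c : ℝ) :
    (∫⁻ y : EuclideanSpace ℝ (Fin 2), ‖w (R (toLp 2 ![y 0, y 1, c]))‖ₑ ^ 2) ^ 2 ≤
      (∫⁻ x, ‖w x‖ₑ ^ 2) * ∫⁻ x, ‖fderiv ℝ w x (R (EuclideanSpace.single 2 1))‖ₑ ^ 2 := by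
  have hwc : Continuous w := hw.continuous
  have hdw : Continuous fun x => fderiv ℝ w x (R (EuclideanSpace.single 2 1)) :=
    (hw.continuous_fderiv one_ne_zero).clm_apply continuous_const
  have hf : AEMeasurable (fun x => ‖w x‖ₑ) volume := (continuous_enorm.comp hwc).measurable.aemeasurable
  have hg : AEMeasurable (fun x => ‖fderiv ℝ w x (R (EuclideanSpace.single 2 1))‖ₑ) volume :=
    (continuous_enorm.comp hdw).measurable.aemeasurable
  have hH := ENNReal.lintegral_mul_le_Lp_mul_Lq volume Real.HolderConjugate.two_two hf hg
  have h1 := planarEnergy_le_lintegral_enorm_mul_enorm_fderiv hw hL2 R c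
  -- square the Hölder bound; `(a^{1/2} b^{1/2})² = a b`
  have hsq : ((∫⁻ x, ‖w x‖ₑ ^ (2 : ℝ)) ^ (1 / (2 : ℝ)) *
      (∫⁻ x, ‖fderiv ℝ w x (R (EuclideanSpace.single 2 1))‖ₑ ^ (2 : ℝ)) ^ (1 / (2 : ℝ))) ^ 2 =
      (∫⁻ x, ‖w x‖ₑ ^ 2) * ∫⁻ x, ‖fderiv ℝ w x (R (EuclideanSpace.single 2 1))‖ₑ ^ 2 := by
    rw [mul_pow, ← ENNReal.rpow_two, ← ENNReal.rpow_two, ← ENNReal.rpow_mul, ← ENNReal.rpow_mul]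
    norm_num
  calc (∫⁻ y : EuclideanSpace ℝ (Fin 2), ‖w (R (toLp 2 ![y 0, y 1, c]))‖ₑ ^ 2) ^ 2
      ≤ (∫⁻ x, ‖w x‖ₑ * ‖fderiv ℝ w x (R (EuclideanSpace.single 2 1))‖ₑ) ^ 2 := by gcongr
    _ ≤ ((∫⁻ x, ‖w x‖ₑ ^ (2 : ℝ)) ^ (1 / (2 : ℝ)) *
      (∫⁻ x, ‖fderiv ℝ w x (R (EuclideanSpace.single 2 1))‖ₑ ^ (2 : ℝ)) ^ (1 / (2 : ℝ))) ^ 2 := by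
        gcongr; simpa using hH
    _ = _ := hsq

omit [InnerProductSpace ℝ F] in
/-- The normal derivative is dominated by the full derivative: `‖Dw(x)(R e₂)‖ ≤ ‖Dw(x)‖`
(`‖R e₂‖ = 1`). -/
theorem enorm_fderiv_apply_isometry_single_le [NormedSpace ℝ F] (w : EuclideanSpace ℝ (Fin 3) → F)
    (R : EuclideanSpace ℝ (Fin 3) ≃ₗᵢ[ℝ] EuclideanSpace ℝ (Fin 3)) (x : EuclideanSpace ℝ (Fin 3)) :
    ‖fderiv ℝ w x (R (EuclideanSpace.single 2 1))‖ₑ ≤ ‖fderiv ℝ w x‖ₑ := by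
  rw [← ofReal_norm, ← ofReal_norm]
  refine ENNReal.ofReal_le_ofReal ?_
  calc ‖fderiv ℝ w x (R (EuclideanSpace.single 2 1))‖
      ≤ ‖fderiv ℝ w x‖ * ‖R (EuclideanSpace.single 2 1)‖ := ContinuousLinearMap.le_opNorm _ _
    _ = ‖fderiv ℝ w x‖ := by rw [LinearIsometryEquiv.norm_map]; simp

/-- **Planar Agmon with the full gradient.** For a `C¹` field `w : ℝ³ → F` with `∫ ‖w‖² < ∞`:
`E(w;R,c)² ≤ (∫ ‖w‖²) · (∫ ‖Dw‖²)` uniformly in the direction `R` and the offset `c` — so the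
planar ceiling `sup_{R,c} E(w;R,c)` is at most `‖w‖_{L²} ‖Dw‖_{L²}` (operator norm of `Dw`, which
is dominated by its Frobenius norm). [folklore] -/
theorem planarEnergy_sq_le_lintegral_mul_lintegral_fderiv' {w : EuclideanSpace ℝ (Fin 3) → F} (hw : ContDiff ℝ 1 w)
    (hL2 : ∫⁻ x, ‖w x‖ₑ ^ 2 < ∞) (R : EuclideanSpace ℝ (Fin 3) ≃ₗᵢ[ℝ] EuclideanSpace ℝ (Fin 3)) (c : ℝ) :
    (∫⁻ y : EuclideanSpace ℝ (Fin 2), ‖w (R (toLp 2 ![y 0, y 1, c]))‖ₑ ^ 2) ^ 2 ≤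
      (∫⁻ x, ‖w x‖ₑ ^ 2) * ∫⁻ x, ‖fderiv ℝ w x‖ₑ ^ 2 := by
  refine (planarEnergy_sq_le_lintegral_mul_lintegral hw hL2 R c).trans ?_
  gcongr with x
  exact enorm_fderiv_apply_isometry_single_le w R x

end Planar

/-- **Planar Agmon with the full gradient** (registered form, sub-goal
`planarEnergy_sq_le_lintegral_mul_lintegral_fderiv` of stmt-NavierStokesRegularity-16855): for every
real inner product space `F` and every `C¹` field `w : ℝ³ → F` with `∫ ‖w‖² < ∞`,
`E(w;R,c)² ≤ (∫ ‖w‖²) · (∫ ‖Dw‖²)` for all linear isometries `R` and offsets `c`. The planar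
ceiling of a finite-energy field is thus at most `‖w‖_{L²} ‖Dw‖_{L²}` — the kinematic a-priori
floor of the crux `PlanarEnergyAPriori` (along a Leray–Hopf solution the planar ceiling is a
priori square-integrable in time; the crux is the `L²_t → L^∞_t` upgrade). [folklore] -/
theorem planarEnergy_sq_le_lintegral_mul_lintegral_fderiv : ∀ {F : Type*} [NormedAddCommGroup F] [InnerProductSpace ℝ F] {w : EuclideanSpace ℝ (Fin 3) → F}, ContDiff ℝ 1 w → ∫⁻ x, ‖w x‖ₑ ^ 2 < ⊤ → ∀ (R : EuclideanSpace ℝ (Fin 3) ≃ₗᵢ[ℝ] EuclideanSpace ℝ (Fin 3)) (c : ℝ), (∫⁻ y : EuclideanSpace ℝ (Fin 2), ‖w (R (WithLp.toLp 2 ![y 0, y 1, c]))‖ₑ ^ 2) ^ 2 ≤ (∫⁻ x, ‖w x‖ₑ ^ 2) * ∫⁻ x, ‖fderiv ℝ w x‖ₑ ^ 2 :=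
  fun hw hL2 R c => planarEnergy_sq_le_lintegral_mul_lintegral_fderiv' hw hL2 R c

end Summit.NavierStokesRegularity.NavierStokesRegularity.Theorems.PlanarEnergyAPriori

end
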